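import Summits.AtomisticToContinuum.FouriersLaw.Theorems.VanishingNoiseTransferVanishingNoiseBoundFlipResponseFrame
import Literature.MathematicalPhysics.KineticTheory.VelocityFlipNoise
import HarnessLib

/-!
# Fixed-`N` linear response of the flip chain: the frame and ROAD A (response density)
(helpers for stub `stub_flipFiniteResponse` of line `sector-dirichlet-gluing`,
crux `VanishingNoiseTransfer.NoisyFourier`, item stmt-AtomisticToContinuum-11977)

The stub `stub_flipFiniteResponse` asks, for the pinned anharmonic chain `pinnedChain ω₂ lam β γ`
(`ω₂, lam, β, γ > 0`) with velocity flips at rate `ε > 0`, GIVEN uniqueness of weak flip steady states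
(`OscillatorChain.IsFlipSteadyState`) and a flip-steady family `μ N T_L T_R`, for the EXISTENCE of the
fixed-`N` response coefficient `D_N(ε) = lim_{δ→0, δ≠0} totalCurrent(μ_{N,T+δ/2,T−δ/2})/δ`.

This file records the frame of that statement and its reduction along ROAD A:

* `flipFamily_unique_frame` — uniqueness + a flip-steady family give the combined
  `IsFlipSteadyState … ∧ ∀ ν, … → ν = μ N T_L T_R` hypothesis of the sister files
  (`…VanishingNoiseBoundFlipResponseFrame`, `family_eq_gibbsMeasure`, `totalCurrent_family_self`);
* `tendsto_response_of_le_one` — `N ≤ 1`: no bond, the quotient is identically `0`, `D = 0`;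
* `tendsto_response_of_endSlope` — `N ≥ 1`, `|δ| < 2T`: by `totalCurrent_family_eq`
  (`totalCurrent(μ_δ) = (N−1)γ(T + δ/2 − ∫ p_0² dμ_δ)`), a slope `s` of the left-end kinetic temperature
  `(∫ p_0² dμ_δ − T)/δ → s` gives `totalCurrent(μ_δ)/δ → (N−1)γ(1/2 − s)`;
* `tendsto_response_of_hasDerivAt` — a derivative at `δ = 0` of `δ ↦ totalCurrent(μ_δ)` at a zero
  (`totalCurrent(μ N T T) = 0`) IS the response limit (`hasDerivAt_iff_tendsto_slope_zero`);
* `flipFiniteResponse_of_responseDensityNoisy` — **ROAD A adapter**: the registered stub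
  `stub_responseDensityNoisy` of the sister crux `NoiseLocality` (stmt-AtomisticToContinuum-11975; its
  statement is the hypothesis, verbatim) — existence of the `L²(μ_T)` linear-response density `U` of the
  unique flip-steady family with `HasDerivAt (δ ↦ totalCurrent(μ_δ)) (Σ_i ∫ j_i U dμ_T) 0` — implies
  `stub_flipFiniteResponse` verbatim, with `D = Σ_i ∫ j_i U dμ_T`.

References: Bonetto–Lebowitz–Rey-Bellet 2000 §5.2–5.3; Bernardin–Olla 2011 §2.1.
-/

noncomputable section

namespace Summit.AtomisticToContinuum.FouriersLaw.Theorems.NoisyFourier.FlipFiniteResponse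

open MeasureTheory Filter Topology Set
open scoped BigOperators
open Literature.MathematicalPhysics.KineticTheory
open Literature.MathematicalPhysics.KineticTheory.HeatConduction
open Summit.AtomisticToContinuum.FouriersLaw.Theorems.VanishingNoiseBound

section Frame

variable {ω₂ lam β γ : ℝ}

/-- **Uniqueness + a flip-steady family give the uniqueness frame.** If flip steady states are unique at
all `N`, `T_L, T_R > 0` and `μ N T_L T_R` is a flip-steady family, then every flip steady state at
`(N, T_L, T_R)` equals `μ N T_L T_R`. [folklore] -/
theorem flipFamily_unique_frame {P : OscillatorChain} {ε : ℝ}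
    (huniq : ∀ (N : ℕ) (T_L T_R : ℝ), 0 < T_L → 0 < T_R → ∀ μ ν : Measure (PhaseSpace N),
      P.IsFlipSteadyState N T_L T_R ε μ → P.IsFlipSteadyState N T_L T_R ε ν → μ = ν)
    {μ : (N : ℕ) → ℝ → ℝ → Measure (PhaseSpace N)}
    (hμ : ∀ (N : ℕ) (T_L T_R : ℝ), 0 < T_L → 0 < T_R →
      P.IsFlipSteadyState N T_L T_R ε (μ N T_L T_R)) :
    ∀ (N : ℕ) (T_L T_R : ℝ), 0 < T_L → 0 < T_R →
      P.IsFlipSteadyState N T_L T_R ε (μ N T_L T_R) ∧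
        ∀ ν : Measure (PhaseSpace N), P.IsFlipSteadyState N T_L T_R ε ν → ν = μ N T_L T_R :=
  fun N T_L T_R hL hR =>
    ⟨hμ N T_L T_R hL hR, fun ν hν => huniq N T_L T_R hL hR ν _ hν (hμ N T_L T_R hL hR)⟩

/-- **No bond, no response**: for `N ≤ 1` the total current vanishes identically
(`OscillatorChain.bondCurrent_eq_zero_of_le`), so the response quotient tends to `0`. [folklore] -/
theorem tendsto_response_of_le_one (P : OscillatorChain) (T : ℝ)
    (μ : (N : ℕ) → ℝ → ℝ → Measure (PhaseSpace N)) {N : ℕ} (hN : N ≤ 1) :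
    Tendsto (fun δ : ℝ => P.totalCurrent (μ N (T + δ / 2) (T - δ / 2)) / δ) (𝓝[≠] 0) (𝓝 0) := by
  have hzero : ∀ ν : Measure (PhaseSpace N), P.totalCurrent ν = 0 := by
    intro ν
    unfold OscillatorChain.totalCurrent
    refine Finset.sum_eq_zero fun i _ => ?_
    have hi : N ≤ i.val + 1 := by have := i.isLt; omega
    simp [P.bondCurrent_eq_zero_of_le i hi]
  simp only [hzero, zero_div]
  exact tendsto_const_nhds

/-- **Response from the end-temperature slope.** In the frame (pinned chain, `ω₂, γ > 0`, `lam, β ≥ 0`,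
flip-steady family `μ`, `T > 0`, `N ≥ 1`): if the left-end kinetic temperature has slope `s` at zero bias,
`(∫ p_0² dμ_{N,T+δ/2,T−δ/2} − T)/δ → s` (`δ → 0`, `δ ≠ 0`), then
`totalCurrent(μ_{N,T+δ/2,T−δ/2})/δ → (N − 1) γ (1/2 − s)` (`totalCurrent_family_eq`).
[Bonetto–Lebowitz–Rey-Bellet 2000, §5.2 eq. (27)] [folklore] -/
theorem tendsto_response_of_endSlope (hω : 0 < ω₂) (hl : 0 ≤ lam) (hβ : 0 ≤ β) (hγ : 0 < γ) {T : ℝ}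
    (hT : 0 < T) {ε : ℝ} {μ : (N : ℕ) → ℝ → ℝ → Measure (PhaseSpace N)}
    (hμ : ∀ (N : ℕ) (T_L T_R : ℝ), 0 < T_L → 0 < T_R →
      (pinnedChain ω₂ lam β γ).IsFlipSteadyState N T_L T_R ε (μ N T_L T_R))
    {N : ℕ} (hN : 0 < N) {s : ℝ}
    (hs : Tendsto (fun δ : ℝ => ((∫ x, x.2 ⟨0, hN⟩ ^ 2 ∂(μ N (T + δ / 2) (T - δ / 2))) - T) / δ)
      (𝓝[≠] 0) (𝓝 s)) :
    Tendsto (fun δ : ℝ => (pinnedChain ω₂ lam β γ).totalCurrent (μ N (T + δ / 2) (T - δ / 2)) / δ)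
      (𝓝[≠] 0) (𝓝 (((N : ℝ) - 1) * γ * (1 / 2 - s))) := by
  refine (((tendsto_const_nhds (x := (1 : ℝ) / 2)).sub hs).const_mul (((N : ℝ) - 1) * γ)).congr' ?_
  filter_upwards [eventually_abs_lt_two_mul hT, self_mem_nhdsWithin] with δ hδ hδ0
  have hδ' : δ ≠ 0 := hδ0
  rw [totalCurrent_family_eq hω hl hβ hγ hμ hN hδ]
  field_simp
  ring

/-- **A derivative at an equilibrium zero is the response limit.** If `totalCurrent(μ T T) = 0` and
`δ ↦ totalCurrent(μ (T+δ/2) (T−δ/2))` has derivative `D` at `0`, then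
`totalCurrent(μ (T+δ/2) (T−δ/2))/δ → D` as `δ → 0`, `δ ≠ 0`. [folklore] -/
theorem tendsto_response_of_hasDerivAt (P : OscillatorChain) {T : ℝ} {N : ℕ}
    {μ : ℝ → ℝ → Measure (PhaseSpace N)} {D : ℝ}
    (h0 : P.totalCurrent (μ T T) = 0)
    (hD : HasDerivAt (fun δ : ℝ => P.totalCurrent (μ (T + δ / 2) (T - δ / 2))) D 0) :
    Tendsto (fun δ : ℝ => P.totalCurrent (μ (T + δ / 2) (T - δ / 2)) / δ) (𝓝[≠] 0) (𝓝 D) := by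
  rw [hasDerivAt_iff_tendsto_slope_zero] at hD
  refine hD.congr' (Eventually.of_forall fun δ => ?_)
  show δ⁻¹ • (P.totalCurrent (μ (T + (0 + δ) / 2) (T - (0 + δ) / 2)) -
    P.totalCurrent (μ (T + 0 / 2) (T - 0 / 2))) = _
  rw [zero_add, zero_div, add_zero, sub_zero, h0, sub_zero, smul_eq_mul, ← div_eq_inv_mul]

end Frame

/-! ## ROAD A: the response density of the sister crux `NoiseLocality` gives the response limit -/

/-- **ROAD A adapter.** The registered stub `stub_responseDensityNoisy` of crux `NoiseLocality`
(stmt-AtomisticToContinuum-11975, verbatim the hypothesis): for the unique rate-`ε` flip-steady family at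
fixed `N` and `T > 0` there is an `L²(μ_T)` response density `U` with, in particular,
`HasDerivAt (δ ↦ totalCurrent(μ_{N,T+δ/2,T−δ/2})) (Σ_i ∫ j_i U dμ_T) 0`. Since the unique family is the
Gibbs measure at zero bias (`family_eq_gibbsMeasure`) and carries no current (`totalCurrent_family_self`),
the response quotient converges to that derivative: this is `stub_flipFiniteResponse` verbatim.
[Bonetto–Lebowitz–Rey-Bellet 2000, §5.3; Bernardin–Olla 2011, §2.1] [folklore] -/
theorem flipFiniteResponse_of_responseDensityNoisy
    (hA : ∀ ω₂ lam β γ : ℝ, 0 < ω₂ → 0 < lam → 0 < β → 0 < γ → ∀ T : ℝ, 0 < T → ∀ (N : ℕ) (ε : ℝ), 0 < ε →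
    ∀ μ : ℝ → ℝ → MeasureTheory.Measure (Literature.MathematicalPhysics.KineticTheory.HeatConduction.PhaseSpace N),
    (∀ T_L T_R : ℝ, 0 < T_L → 0 < T_R →
      (Literature.MathematicalPhysics.KineticTheory.HeatConduction.pinnedChain ω₂ lam β γ).IsFlipSteadyState N T_L T_R ε
          (μ T_L T_R) ∧
        ∀ ν : MeasureTheory.Measure (Literature.MathematicalPhysics.KineticTheory.HeatConduction.PhaseSpace N),
          (Literature.MathematicalPhysics.KineticTheory.HeatConduction.pinnedChain ω₂ lam β γ).IsFlipSteadyState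
              N T_L T_R ε ν → ν = μ T_L T_R) →
    ∃ U : Literature.MathematicalPhysics.KineticTheory.HeatConduction.PhaseSpace N → ℝ,
      MeasureTheory.MemLp U 2
          ((Literature.MathematicalPhysics.KineticTheory.HeatConduction.pinnedChain ω₂ lam β γ).gibbsMeasure N T) ∧
        (∀ g : Literature.MathematicalPhysics.KineticTheory.HeatConduction.PhaseSpace N → ℝ,
          ContDiff ℝ ((⊤ : ℕ∞) : WithTop ℕ∞) g → HasCompactSupport g →
            HasDerivAt (fun δ : ℝ => ∫ x, g x ∂(μ (T + δ / 2) (T - δ / 2)))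
              (∫ x, g x * U x
                ∂((Literature.MathematicalPhysics.KineticTheory.HeatConduction.pinnedChain ω₂ lam β γ).gibbsMeasure N T))
              0) ∧
        HasDerivAt (fun δ : ℝ =>
            (Literature.MathematicalPhysics.KineticTheory.HeatConduction.pinnedChain ω₂ lam β γ).totalCurrent
              (μ (T + δ / 2) (T - δ / 2)))
          (∑ i : Fin N, ∫ x,
            (Literature.MathematicalPhysics.KineticTheory.HeatConduction.pinnedChain ω₂ lam β γ).bondCurrent N i x * U x
              ∂((Literature.MathematicalPhysics.KineticTheory.HeatConduction.pinnedChain ω₂ lam β γ).gibbsMeasure N T))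
          0) :
    ∀ ω₂ lam β γ : ℝ, 0 < ω₂ → 0 < lam → 0 < β → 0 < γ → ∀ ε : ℝ, 0 < ε →
      (∀ (N : ℕ) (T_L T_R : ℝ), 0 < T_L → 0 < T_R →
        ∀ μ ν : MeasureTheory.Measure
            (Literature.MathematicalPhysics.KineticTheory.HeatConduction.PhaseSpace N),
          (Literature.MathematicalPhysics.KineticTheory.HeatConduction.pinnedChain
              ω₂ lam β γ).IsFlipSteadyState N T_L T_R ε μ →
          (Literature.MathematicalPhysics.KineticTheory.HeatConduction.pinnedChain
              ω₂ lam β γ).IsFlipSteadyState N T_L T_R ε ν → μ = ν) →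
      ∀ μ : (N : ℕ) → ℝ → ℝ → MeasureTheory.Measure
          (Literature.MathematicalPhysics.KineticTheory.HeatConduction.PhaseSpace N),
        (∀ (N : ℕ) (T_L T_R : ℝ), 0 < T_L → 0 < T_R →
          (Literature.MathematicalPhysics.KineticTheory.HeatConduction.pinnedChain
              ω₂ lam β γ).IsFlipSteadyState N T_L T_R ε (μ N T_L T_R)) →
        ∀ T : ℝ, 0 < T → ∀ N : ℕ, ∃ D : ℝ,
          Filter.Tendsto (fun δ : ℝ =>
            (Literature.MathematicalPhysics.KineticTheory.HeatConduction.pinnedChain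
                ω₂ lam β γ).totalCurrent (μ N (T + δ / 2) (T - δ / 2)) / δ)
            (nhdsWithin 0 {(0 : ℝ)}ᶜ) (nhds D) := by
  intro ω₂ lam β γ hω hl hβ hγ ε hε huniq μ hμ T hT N
  have hframe := flipFamily_unique_frame huniq hμ
  obtain ⟨U, -, -, hD⟩ := hA ω₂ lam β γ hω hl hβ hγ T hT N ε hε (μ N)
    (fun T_L T_R hL hR => hframe N T_L T_R hL hR)
  exact ⟨_, tendsto_response_of_hasDerivAt (pinnedChain ω₂ lam β γ)
    (totalCurrent_family_self hω hl.le hβ.le γ ε hframe N hT) hD⟩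

/-! ## Registered helper -/

/-- Registered helper sub-goal `helper_flipFiniteResponseOfResponseDensityNoisy` of stub `stub_flipFiniteResponse`
(line `sector-dirichlet-gluing`, crux stmt-AtomisticToContinuum-11977): ROAD A, the registered stub
`stub_responseDensityNoisy` of stmt-AtomisticToContinuum-11975 (verbatim) implies `stub_flipFiniteResponse` (verbatim)
(`flipFiniteResponse_of_responseDensityNoisy`, notation-free restatement). [folklore] -/
theorem helper_flipFiniteResponseOfResponseDensityNoisy : (∀ ω₂ lam β γ : ℝ, 0 < ω₂ → 0 < lam → 0 < β → 0 < γ → ∀ T : ℝ, 0 < T → ∀ (N : ℕ) (ε : ℝ), 0 < ε → ∀ μ : ℝ → ℝ → MeasureTheory.Measure (Literature.MathematicalPhysics.KineticTheory.HeatConduction.PhaseSpace N), (∀ T_L T_R : ℝ, 0 < T_L → 0 < T_R → (Literature.MathematicalPhysics.KineticTheory.HeatConduction.pinnedChain ω₂ lam β γ).IsFlipSteadyState N T_L T_R ε (μ T_L T_R) ∧ ∀ ν : MeasureTheory.Measure (Literature.MathematicalPhysics.KineticTheory.HeatConduction.PhaseSpace N), (Literature.MathematicalPhysics.KineticTheory.HeatConduction.pinnedChain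 ω₂ lam β γ).IsFlipSteadyState N T_L T_R ε ν → ν = μ T_L T_R) → ∃ U : Literature.MathematicalPhysics.KineticTheory.HeatConduction.PhaseSpace N → ℝ, MeasureTheory.MemLp U 2 ((Literature.MathematicalPhysics.KineticTheory.HeatConduction.pinnedChain ω₂ lam β γ).gibbsMeasure N T) ∧ (∀ g : Literature.MathematicalPhysics.KineticTheory.HeatConduction.PhaseSpace N → ℝ, ContDiff ℝ ((⊤ : ℕ∞) : WithTop ℕ∞) g → HasCompactSupport g → HasDerivAt (fun δ : ℝ => ∫ x, g x ∂(μ (T + δ / 2) (T - δ / 2))) (∫ x, g x * U x ∂((Literature.MathematicalPhysics.KineticTheory.HeatConduction.pinnedChain ω₂ lam β γ).gibbsMeasure N T)) 0) ∧ HasDerivAt (fun δ : ℝ => (Literature.MathematicalPhysics.KineticTheory.HeatConduction.pinnedChain ω₂ lam β γ).totalCurrent (μ (T + δ / 2) (T - δ / 2))) (∑ i : Fin N, ∫ x, (Literature.MathematicalPhysics.KineticTheory.HeatConduction.pinnedChain ω₂ lam β γ).bondCurrent N i x * U x ∂((Literature.MathematicalPhysics.KineticTheory.HeatConduction.pinnedChain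 ω₂ lam β γ).gibbsMeasure N T)) 0) → ∀ ω₂ lam β γ : ℝ, 0 < ω₂ → 0 < lam → 0 < β → 0 < γ → ∀ ε : ℝ, 0 < ε → (∀ (N : ℕ) (T_L T_R : ℝ), 0 < T_L → 0 < T_R → ∀ μ ν : MeasureTheory.Measure (Literature.MathematicalPhysics.KineticTheory.HeatConduction.PhaseSpace N), (Literature.MathematicalPhysics.KineticTheory.HeatConduction.pinnedChain ω₂ lam β γ).IsFlipSteadyState N T_L T_R ε μ → (Literature.MathematicalPhysics.KineticTheory.HeatConduction.pinnedChain ω₂ lam β γ).IsFlipSteadyState N T_L T_R ε ν → μ = ν) → ∀ μ : (N : ℕ) → ℝ → ℝ → MeasureTheory.Measure (Literature.MathematicalPhysics.KineticTheory.HeatConduction.PhaseSpace N), (∀ (N : ℕ) (T_L T_R : ℝ), 0 < T_L → 0 < T_R → (Literature.MathematicalPhysics.KineticTheory.HeatConduction.pinnedChain ω₂ lam β γ).IsFlipSteadyState N T_L T_R ε (μ N T_L T_R)) → ∀ T : ℝ, 0 < T → ∀ N : ℕ, ∃ D : ℝ, Filter.Tendsto (fun δ : ℝ => (Literature.MathematicalPhysics.KineticTheory.HeatConduction.pinnedChain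 ω₂ lam β γ).totalCurrent (μ N (T + δ / 2) (T - δ / 2)) / δ) (nhdsWithin 0 {(0 : ℝ)}ᶜ) (nhds D) :=
  flipFiniteResponse_of_responseDensityNoisy

end Summit.AtomisticToContinuum.FouriersLaw.Theorems.NoisyFourier.FlipFiniteResponse

end
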